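import Literature.NumberTheory.Automorphic.UnitaryGroupArchCayleyJacobian
import Literature.MeasureTheory.Group.HaarLocalChartLeft
import Mathlib.MeasureTheory.Function.Jacobian
import HarnessLib

/-!
# Haar measure of `U(J)(E ⊗ ℝ)` in the Cayley chart: on a window `ĉ(V₀)` at `1`, `μ|_{ĉ(V₀)} = ĉ_*(w · λ|_{V₀})` with a continuous
# positive density `w` on `V₀ ⊆ 𝔲` — for EVERY Haar measure `μ` of `U(J)(E ⊗ ℝ)` and EVERY Lebesgue (additive Haar) measure `λ` on `𝔲`
(Helgason, *Groups and Geometric Analysis* (2000), Ch. I §1 Thm. 1.14 (13) p. 96 «`∫_G f(g) dg = ∫_𝔤 f(exp X) det((1 − e^{−adX})/adX) dX`»,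
here with the Cayley chart in place of `exp`; Knapp, *Lie Groups Beyond an Introduction* (2002), VIII §2 (Haar measure in coordinates);
Weyl, *The Classical Groups* (1939), Ch. II §10.)

Topic `NumberTheory/Automorphic`; namespace `Literature.NumberTheory.Automorphic.UnitaryGroup`.  One definition with body (`cayleyChartMeasure`) and
proved theorems: no named fact, no instance, no notation, no `sorry`.  Cell `hodgecm-mathlib`, F0∕P3 road «DM∞» (archimedean Dixmier–Malliavin,
weak form, for `U(H)(L⁺ ⊗ ℝ)`; census `F0/P3/p03/CENSUS-DMinf.F0P3p03g8.md`), brick B5b, measure half (over ★ `UnitaryGroupArchCayleyJacobian`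
and the averaging lemma ★ `Literature.MeasureTheory.Group.HaarLocalChartLeft` p833855).  Consumer: the road's B6 (`UnitaryGroupArchSecondKindHaar`:
coordinates of the second kind `s ↦ Π exp(s_i X_i)` compared with `ĉ` by the inverse function theorem).

SETTING: `G = U(J)(E ⊗ ℝ) = arch F E c N J` with its Borel σ-algebra (`[MeasurableSpace] [BorelSpace]` binders; ★ `UnitaryGroupArchTopology`:
second countable locally compact group), `𝔲 = archSkew F E c N J` with its Borel σ-algebra, `ĉ = cayleyChart`, source `{1 ± X invertible}`,
`w₀ = cayleyWeight = |det m_·|⁻¹`, transition maps `τ_k` (★ `UnitaryGroupArchCayleyJacobian`).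

THE ARGUMENT.  (§2) The chart measure `ν := ĉ_*(w₀ · λ|_{V₀})` (`V₀ ⊆` source, open) is carried by the open window `W = ĉ(V₀)` and is LOCALLY
LEFT-INVARIANT there: for `k ∈ G` and measurable `B ⊆ W` with `k⁻¹B ⊆ W`, the chart images `D = ĉ⁻¹B ∩ V₀` and `D′ = ĉ⁻¹(k⁻¹B) ∩ V₀` satisfy
`τ_k(D′) = D`, `τ_k` is injective and differentiable on `D′` (★ `hasFDerivAt_cayleyTrans`), so Mathlib's change of variables
(`lintegral_image_eq_lintegral_abs_det_fderiv_mul` on the finite-dimensional space `𝔲`) and the weight cocycle `|det Dτ_k| · (w₀ ∘ τ_k) = w₀`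
(★ `abs_det_cayleyTransDeriv_mul_cayleyWeight`) give `ν(B) = ∫_D w₀ = ∫_{D′} w₀ = ν(k⁻¹B)`.  (§3) With `V₀` a ball whose closure lies in the source,
`W` is open, non-empty, relatively compact; the averaging lemma gives `ν = κ • μ|_W`; `0 < κ < ∞` because `0 < ν(W) < ∞` (`w₀` positive and bounded on
`V₀`) and `0 < μ(W) < ∞`; hence `μ|_W = ĉ_*(κ⁻¹ w₀ · λ|_{V₀})`.

CONTENT.
* §1 `exists_closedBall_subset_cayleySource`, `measurable_cayleyWeight`, `measurable_cayleyChart`;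
* §2 **`cayleyChartMeasure F E c N J λ V₀ = ĉ_*(w₀ · λ|_{V₀})`**, `cayleyChartMeasure_apply` (`ν(S) = ∫_{ĉ⁻¹S ∩ V₀} w₀ dλ`),
  `cayleyChartMeasure_compl_image` (`ν` is carried by `ĉ(V₀)`), **`cayleyChartMeasure_preimage_mul`** (local left-invariance);
* §3 **`exists_restrict_image_cayleyChart_eq_map`**: `∃ V₀ w, IsOpen V₀ ∧ 0 ∈ V₀ ∧ V₀ ⊆ source ∧ ContinuousOn w V₀ ∧ (∀ X ∈ V₀, 0 < w X) ∧
  IsOpen (ĉ '' V₀) ∧ μ.restrict (ĉ '' V₀) = map ĉ ((λ.restrict V₀).withDensity (ofReal ∘ w))`, and the same without the source conjunct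
  (`exists_restrict_image_cayleyChart_eq_map'`, the road's B5b head verbatim).

HONEST SCOPE.  Measure theory over the two companions and Mathlib's Jacobian change-of-variables formula; no manifold structure, no Lie theory, no
evaluation of the constant `κ` or of the density in closed form.  HC_CM is proved only modulo the printed citations until rung 0 closes; this file
discharges no printed statement (banked currency for the road's B6∕B7).

## References
* S. Helgason, *Groups and Geometric Analysis*, AMS Math. Surveys Monogr. 83 (2000), Ch. I §1, Prop. 1.13 and Thm. 1.14 (12)–(13), p. 96. [Helgason2000]
* A. W. Knapp, *Lie Groups Beyond an Introduction*, 2nd ed., Birkhäuser (2002), VIII §2. [Knapp2002]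
* H. Weyl, *The Classical Groups, their Invariants and Representations*, Princeton (1939), Ch. II §10. [Weyl1939]
-/

set_option autoImplicit false

noncomputable section

open NumberField NumberField.mixedEmbedding Set Filter Topology MeasureTheory MeasureTheory.Measure Literature.Analysis.Calculus
open scoped Classical Matrix Matrix.Norms.Operator MatrixGroups ENNReal NNReal Pointwise

namespace Literature.NumberTheory.Automorphic

namespace UnitaryGroup

section Haar

variable (F E : Type) [Field F] [Field E] [NumberField E] [Algebra F E] (c : E ≃ₐ[F] E) (N : ℕ) (J : Matrix (Fin N) (Fin N) E)

variable {F E c N}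

/-! ## §1 The chart window: a ball of `𝔲` inside the source; measurability of the weight and of the chart -/

/-- A closed ball of `𝔲` around `0` inside the chart source. [cite: Weyl1939, Ch. II §10] -/
theorem exists_closedBall_subset_cayleySource :
    ∃ r : ℝ, 0 < r ∧ Metric.closedBall (0 : archSkew F E c N J) r ⊆ cayleySource F E c N J := by
  obtain ⟨ε, hε, hball⟩ := Metric.isOpen_iff.1 (isOpen_cayleySource (F := F) (c := c) J) 0 (zero_mem_cayleySource J)
  exact ⟨ε / 2, half_pos hε, (Metric.closedBall_subset_ball (half_lt_self hε)).trans hball⟩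

variable [MeasurableSpace (archSkew F E c N J)] [BorelSpace (archSkew F E c N J)]

/-- The Cayley weight is measurable. [cite: Weyl1939, Ch. II §10] -/
theorem measurable_cayleyWeight : Measurable (cayleyWeight F E c N J) :=
  (continuous_det_skewMulL J).abs.measurable.inv

variable [MeasurableSpace (arch F E c N J)] [BorelSpace (arch F E c N J)]

/-- The Cayley chart is measurable (continuous on the open source, constant off it). [cite: Weyl1939, Ch. II §10] -/
theorem measurable_cayleyChart : Measurable (cayleyChart F E c N J) := by
  have e : cayleyChart F E c N J = (cayleySource F E c N J).piecewise (cayleyChart F E c N J) fun _ => 1 := by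
    funext X
    by_cases hX : X ∈ cayleySource F E c N J
    · rw [Set.piecewise_eq_of_mem _ _ _ hX]
    · rw [Set.piecewise_eq_of_notMem _ _ _ hX, cayleyChart_of_not_mem J hX]
  rw [e]
  exact (continuousOn_cayleyChart J).measurable_piecewise continuousOn_const (isOpen_cayleySource J).measurableSet

/-! ## §2 The chart measure `ν = ĉ_*(w₀ · λ|_{V₀})` and its local left-invariance -/

variable (F E c N) in
/-- The chart measure on `U(J)(E ⊗ ℝ)`: the push-forward under `ĉ` of `w₀ · λ` restricted to the window `V₀ ⊆ 𝔲`.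
[cite: Helgason2000, Ch. I §1 Thm. 1.14 (13) p. 96] -/
def cayleyChartMeasure (lam : Measure (archSkew F E c N J)) (V₀ : Set (archSkew F E c N J)) : Measure (arch F E c N J) :=
  Measure.map (cayleyChart F E c N J) ((lam.restrict V₀).withDensity fun X => ENNReal.ofReal (cayleyWeight F E c N J X))

/-- The chart measure of a measurable set: `ν(S) = ∫_{ĉ⁻¹ S ∩ V₀} w₀ dλ`. [cite: Helgason2000, Ch. I §1 Thm. 1.14 (13) p. 96] -/
theorem cayleyChartMeasure_apply (lam : Measure (archSkew F E c N J)) (V₀ : Set (archSkew F E c N J))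
    {S : Set (arch F E c N J)} (hS : MeasurableSet S) :
    cayleyChartMeasure F E c N J lam V₀ S = ∫⁻ X in cayleyChart F E c N J ⁻¹' S ∩ V₀, ENNReal.ofReal (cayleyWeight F E c N J X) ∂lam := by
  rw [cayleyChartMeasure, Measure.map_apply (measurable_cayleyChart J) hS,
    withDensity_apply _ ((measurable_cayleyChart J) hS), Measure.restrict_restrict ((measurable_cayleyChart J) hS)]

/-- The chart measure is carried by the chart image of the window. [cite: Helgason2000, Ch. I §1 Thm. 1.14 (13) p. 96] -/
theorem cayleyChartMeasure_compl_image (lam : Measure (archSkew F E c N J)) {V₀ : Set (archSkew F E c N J)}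
    (hV₀s : V₀ ⊆ cayleySource F E c N J) (hV₀o : IsOpen V₀) :
    cayleyChartMeasure F E c N J lam V₀ (cayleyChart F E c N J '' V₀)ᶜ = 0 := by
  rw [cayleyChartMeasure_apply J lam V₀ (isOpen_image_cayleyChart J hV₀s hV₀o).measurableSet.compl]
  have he : cayleyChart F E c N J ⁻¹' (cayleyChart F E c N J '' V₀)ᶜ ∩ V₀ = ∅ := by
    ext X
    simp only [Set.mem_inter_iff, Set.mem_preimage, Set.mem_compl_iff, Set.mem_image, Set.mem_empty_iff_false, iff_false, not_and]
    intro hX hXV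
    exact hX ⟨X, hXV, rfl⟩
  rw [he, Measure.restrict_empty, lintegral_zero_measure]

-- the scoped normed structure on the submodule `𝔲 ≤ M_N(E ⊗ ℝ)` is only reducibly defeq to the subtype uniformity (as in ★ `ArchTestKcPackage`)
set_option backward.isDefEq.respectTransparency false in
/-- **LOCAL LEFT-INVARIANCE OF THE CHART MEASURE** on the window `W = ĉ(V₀)` (`V₀ ⊆` source): for `k ∈ U(J)(E ⊗ ℝ)` and measurable
`B ⊆ W` with `k⁻¹B ⊆ W`, `ν(k⁻¹B) = ν(B)` — the change of variables `X ↦ τ_k X` on `𝔲` (Mathlib's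
`lintegral_image_eq_lintegral_abs_det_fderiv_mul`) and the weight cocycle `|det Dτ_k| · w₀ ∘ τ_k = w₀` (★ `UnitaryGroupArchCayleyJacobian`).
[cite: Helgason2000, Ch. I §1 Thm. 1.14 (13) p. 96] -/
theorem cayleyChartMeasure_preimage_mul (lam : Measure (archSkew F E c N J)) [lam.IsAddHaarMeasure] {V₀ : Set (archSkew F E c N J)}
    (hV₀ : MeasurableSet V₀) (hV₀s : V₀ ⊆ cayleySource F E c N J) (k : arch F E c N J) {B : Set (arch F E c N J)} (hB : MeasurableSet B)
    (hBW : B ⊆ cayleyChart F E c N J '' V₀) (hkB : (fun g => k * g) ⁻¹' B ⊆ cayleyChart F E c N J '' V₀) :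
    cayleyChartMeasure F E c N J lam V₀ ((fun g => k * g) ⁻¹' B) = cayleyChartMeasure F E c N J lam V₀ B := by
  haveI : FiniteDimensional ℝ (Matrix (Fin N) (Fin N) (mixedSpace E)) := finiteDimensional_matrix
  obtain ⟨P, hP⟩ := exists_retraction_archSkew (F := F) (E := E) (c := c) (N := N) J
  have hkBm : MeasurableSet ((fun g => k * g) ⁻¹' B) := (measurable_const_mul k) hB
  rw [cayleyChartMeasure_apply J lam V₀ hB, cayleyChartMeasure_apply J lam V₀ hkBm]
  -- the two chart images `D = ĉ⁻¹B ∩ V₀`, `D' = ĉ⁻¹(k⁻¹B) ∩ V₀`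
  set D := cayleyChart F E c N J ⁻¹' B ∩ V₀ with hD
  set D' := cayleyChart F E c N J ⁻¹' ((fun g => k * g) ⁻¹' B) ∩ V₀ with hD'
  have hD'm : MeasurableSet D' := ((measurable_cayleyChart J) hkBm).inter hV₀
  -- `D' ⊆` source of `τ_k`
  have hD's : D' ⊆ cayleyTransSource F E c N J k := by
    intro X hX
    refine ⟨hV₀s hX.2, ?_⟩
    have hmem : k * cayleyChart F E c N J X ∈ cayleyChart F E c N J '' cayleySource F E c N J :=
      Set.image_mono hV₀s (hBW hX.1)
    rw [cayleyChart_image_cayleySource] at hmem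
    exact hmem
  -- `τ_k(D') = D`
  have himage : cayleyTrans F E c N J k '' D' = D := by
    ext Y
    constructor
    · rintro ⟨X, hX, rfl⟩
      have hXs := hD's hX
      refine ⟨?_, ?_⟩
      · show cayleyChart F E c N J (cayleyTrans F E c N J k X) ∈ B
        rw [cayleyChart_cayleyTrans J hXs]
        exact hX.1
      · -- `τ_k X = cayleyInv (k ĉ X)` with `k ĉ X ∈ ĉ(V₀)`
        have hX1 : k * cayleyChart F E c N J X ∈ B := hX.1
        obtain ⟨Z, hZ, hZe⟩ := hBW hX1
        rw [cayleyTrans, ← hZe, cayleyInv_cayleyChart J (hV₀s hZ)]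
        exact hZ
    · intro hY
      -- `X := cayleyInv (k⁻¹ ĉ Y)`; `k⁻¹ ĉ Y ∈ ĉ(V₀)` because `k (k⁻¹ ĉ Y) = ĉ Y ∈ B`
      have hk : k⁻¹ * cayleyChart F E c N J Y ∈ cayleyChart F E c N J '' V₀ := by
        apply hkB
        show k * (k⁻¹ * cayleyChart F E c N J Y) ∈ B
        rw [← mul_assoc, mul_inv_cancel, one_mul]
        exact hY.1
      obtain ⟨X, hXV, hXe⟩ := hk
      refine ⟨X, ⟨?_, hXV⟩, ?_⟩
      · show cayleyChart F E c N J X ∈ (fun g => k * g) ⁻¹' B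
        rw [Set.mem_preimage, hXe, ← mul_assoc, mul_inv_cancel, one_mul]
        exact hY.1
      · rw [cayleyTrans, hXe, ← mul_assoc, mul_inv_cancel, one_mul, cayleyInv_cayleyChart J (hV₀s hY.2)]
  -- the derivative of `τ_k` on `D'` (junk `0` off the source)
  set f' : archSkew F E c N J → archSkew F E c N J →L[ℝ] archSkew F E c N J :=
    fun X => if h : X ∈ cayleyTransSource F E c N J k then cayleyTransDeriv F E c N J P k X h else 0 with hf'
  have hf'e : ∀ {X} (h : X ∈ cayleyTransSource F E c N J k), f' X = cayleyTransDeriv F E c N J P k X h := by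
    intro X h
    exact dif_pos h
  have hderiv : ∀ X ∈ D', HasFDerivWithinAt (cayleyTrans F E c N J k) (f' X) D' X := by
    intro X hX
    rw [hf'e (hD's hX)]
    exact (hasFDerivAt_cayleyTrans J hP (hD's hX)).hasFDerivWithinAt
  -- change of variables
  have hcv := lintegral_image_eq_lintegral_abs_det_fderiv_mul lam hD'm hderiv ((injOn_cayleyTrans J k).mono hD's)
    (fun X => ENNReal.ofReal (cayleyWeight F E c N J X))
  rw [himage] at hcv
  rw [hcv]
  refine setLIntegral_congr_fun hD'm fun X hX => ?_
  rw [hf'e (hD's hX), ← ENNReal.ofReal_mul (abs_nonneg _), abs_det_cayleyTransDeriv_mul_cayleyWeight J hP (hD's hX)]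

/-! ## §3 Haar measure of `U(J)(E ⊗ ℝ)` on the chart window is `ĉ_*(w · λ)` -/

-- the scoped normed structure on the submodule `𝔲 ≤ M_N(E ⊗ ℝ)` is only reducibly defeq to the subtype uniformity (as in ★ `ArchTestKcPackage`)
set_option backward.isDefEq.respectTransparency false in
/-- **HAAR MEASURE OF `U(J)(E ⊗ ℝ)` IN THE CAYLEY CHART.**  For EVERY Haar measure `μ` on `G = U(J)(E ⊗ ℝ)` (Borel σ-algebra) and EVERY
additive Haar measure `λ` on `𝔲` (Borel σ-algebra) there are an open window `0 ∈ V₀ ⊆ 𝔲` inside the source of the Cayley chart `ĉ` and a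
continuous positive weight `w` on `V₀` with `ĉ(V₀)` open in `G` and

  `μ|_{ĉ(V₀)} = ĉ_*(w · λ|_{V₀})`,

i.e. `∫_{ĉ(V₀)} F dμ = ∫_{V₀} F(ĉ X) w(X) dλ(X)`: Haar measure in Cayley coordinates has a continuous positive density (`w = κ⁻¹ w₀`,
`w₀ = |det m_·|⁻¹` ★ `cayleyWeight`, `κ` the constant of the averaging lemma ★ `HaarLocalChartLeft.eq_smul_restrict_of_locallyInvariant_of_isOpen`
applied to the locally left-invariant chart measure `ĉ_*(w₀ · λ|_{V₀})`, §2).  [cite: Helgason2000, Ch. I §1 Thm. 1.14 (13) p. 96]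
[cite: Knapp2002, VIII §2] -/
theorem exists_restrict_image_cayleyChart_eq_map (μa : Measure (arch F E c N J)) [μa.IsHaarMeasure]
    (lam : Measure (archSkew F E c N J)) [lam.IsAddHaarMeasure] :
    ∃ (V₀ : Set (archSkew F E c N J)) (w : archSkew F E c N J → ℝ),
      IsOpen V₀ ∧ (0 : archSkew F E c N J) ∈ V₀ ∧ V₀ ⊆ cayleySource F E c N J ∧ ContinuousOn w V₀ ∧ (∀ X ∈ V₀, 0 < w X) ∧
      IsOpen (cayleyChart F E c N J '' V₀) ∧
      μa.restrict (cayleyChart F E c N J '' V₀) =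
        Measure.map (cayleyChart F E c N J) ((lam.restrict V₀).withDensity fun X => ENNReal.ofReal (w X)) := by
  haveI : FiniteDimensional ℝ (Matrix (Fin N) (Fin N) (mixedSpace E)) := finiteDimensional_matrix
  obtain ⟨r, hr, hball⟩ := exists_closedBall_subset_cayleySource (F := F) (c := c) J
  set V₀ : Set (archSkew F E c N J) := Metric.ball 0 r with hV₀
  have hV₀o : IsOpen V₀ := Metric.isOpen_ball
  have hV₀s : V₀ ⊆ cayleySource F E c N J := Metric.ball_subset_closedBall.trans hball
  have h0 : (0 : archSkew F E c N J) ∈ V₀ := Metric.mem_ball_self hr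
  set W := cayleyChart F E c N J '' V₀ with hW
  have hWo : IsOpen W := isOpen_image_cayleyChart J hV₀s hV₀o
  have hWne : W.Nonempty := ⟨_, ⟨0, h0, rfl⟩⟩
  have hK : IsCompact (cayleyChart F E c N J '' Metric.closedBall 0 r) :=
    (isCompact_closedBall (0 : archSkew F E c N J) r).image_of_continuousOn ((continuousOn_cayleyChart J).mono hball)
  have hWc : IsCompact (closure W) := hK.closure_of_subset (Set.image_mono Metric.ball_subset_closedBall)
  -- the chart measure and its properties (§2)
  set ν := cayleyChartMeasure F E c N J lam V₀ with hν
  haveI : SFinite ν := by rw [hν, cayleyChartMeasure]; infer_instance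
  have hνW : ν Wᶜ = 0 := cayleyChartMeasure_compl_image J lam hV₀s hV₀o
  have hloc : ∀ (g : arch F E c N J) (B : Set (arch F E c N J)), MeasurableSet B → B ⊆ W → (fun x => g * x) ⁻¹' B ⊆ W →
      ν ((fun x => g * x) ⁻¹' B) = ν B :=
    fun g B hB hBW hgB => cayleyChartMeasure_preimage_mul J lam hV₀o.measurableSet hV₀s g hB hBW hgB
  -- the averaging lemma: `ν = κ • μ|_W`
  obtain ⟨κ, hκ⟩ : ∃ κ : ℝ≥0∞, ν = κ • μa.restrict W :=
    ⟨_, Literature.MeasureTheory.Group.HaarLocalChartLeft.eq_smul_restrict_of_locallyInvariant_of_isOpen (μ := μa) (ν := ν)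
      hWo hWne hWc hνW hloc⟩
  -- `0 < μ W < ∞`, `0 < ν W < ∞`, hence `0 < κ < ∞`
  have hμW0 : μa W ≠ 0 := (hWo.measure_pos μa hWne).ne'
  have hμWtop : μa W ≠ ⊤ := ((measure_mono subset_closure).trans_lt hWc.measure_lt_top).ne
  have hνWeq : ν W = ∫⁻ X in V₀, ENNReal.ofReal (cayleyWeight F E c N J X) ∂lam := by
    have hVW : cayleyChart F E c N J ⁻¹' W ∩ V₀ = V₀ := Set.inter_eq_right.2 fun X hX => ⟨X, hX, rfl⟩
    rw [hν, cayleyChartMeasure_apply J lam V₀ hWo.measurableSet, hVW]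
  have hνW0 : ν W ≠ 0 := by
    rw [hνWeq]
    refine ne_of_gt ?_
    rw [lintegral_pos_iff_support (measurable_cayleyWeight J).ennreal_ofReal, Measure.restrict_apply' hV₀o.measurableSet]
    have hsub : V₀ ⊆ (Function.support fun X => ENNReal.ofReal (cayleyWeight F E c N J X)) ∩ V₀ :=
      fun X hX => ⟨(ENNReal.ofReal_pos.2 (cayleyWeight_pos J (hV₀s hX))).ne', hX⟩
    exact (hV₀o.measure_pos lam ⟨0, h0⟩).trans_le (measure_mono hsub)
  have hνWtop : ν W ≠ ⊤ := by
    obtain ⟨X₀, hX₀, hmax⟩ := (isCompact_closedBall (0 : archSkew F E c N J) r).exists_isMaxOn ⟨0, Metric.mem_closedBall_self hr.le⟩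
      ((continuousOn_cayleyWeight J).mono hball)
    rw [hνWeq]
    refine ne_of_lt ?_
    calc ∫⁻ X in V₀, ENNReal.ofReal (cayleyWeight F E c N J X) ∂lam
        ≤ ∫⁻ X in V₀, ENNReal.ofReal (cayleyWeight F E c N J X₀) ∂lam :=
          setLIntegral_mono measurable_const fun X hX => ENNReal.ofReal_le_ofReal (hmax (Metric.ball_subset_closedBall hX))
      _ = ENNReal.ofReal (cayleyWeight F E c N J X₀) * lam V₀ := setLIntegral_const _ _
      _ < ⊤ := ENNReal.mul_lt_top ENNReal.ofReal_lt_top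
          ((measure_mono Metric.ball_subset_closedBall).trans_lt (isCompact_closedBall (0 : archSkew F E c N J) r).measure_lt_top)
  have hκW : ν W = κ * μa W := by
    have := congrArg (fun m : Measure (arch F E c N J) => m W) hκ
    simpa only [Measure.smul_apply, smul_eq_mul, Measure.restrict_apply_self] using this
  have hκ0 : κ ≠ 0 := by
    intro h; rw [h, zero_mul] at hκW; exact hνW0 hκW
  have hκtop : κ ≠ ⊤ := by
    intro h; rw [h, ENNReal.top_mul hμW0] at hκW; exact hνWtop hκW
  -- the weight `w = κ⁻¹ w₀`
  refine ⟨V₀, fun X => κ⁻¹.toReal * cayleyWeight F E c N J X, hV₀o, h0, hV₀s,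
    continuousOn_const.mul ((continuousOn_cayleyWeight J).mono hV₀s),
    fun X hX => mul_pos (ENNReal.toReal_pos (ENNReal.inv_ne_zero.2 hκtop) (ENNReal.inv_ne_top.2 hκ0)) (cayleyWeight_pos J (hV₀s hX)),
    hWo, ?_⟩
  have hfun : (fun X => ENNReal.ofReal (κ⁻¹.toReal * cayleyWeight F E c N J X)) =
      κ⁻¹ • fun X => ENNReal.ofReal (cayleyWeight F E c N J X) := by
    funext X
    rw [Pi.smul_apply, smul_eq_mul, ENNReal.ofReal_mul ENNReal.toReal_nonneg, ENNReal.ofReal_toReal (ENNReal.inv_ne_top.2 hκ0)]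
  rw [hfun, withDensity_smul' _ _ (ENNReal.inv_ne_top.2 hκ0), Measure.map_smul]
  change μa.restrict W = κ⁻¹ • ν
  rw [hκ, smul_smul, ENNReal.inv_mul_cancel hκ0 hκtop, one_smul]

/-- **The road's B5b head, verbatim shape** (the source conjunct dropped): for every Haar `μ` on `U(J)(E ⊗ ℝ)` and every additive Haar `λ` on `𝔲`,
`∃ V₀ w, IsOpen V₀ ∧ 0 ∈ V₀ ∧ ContinuousOn w V₀ ∧ (∀ X ∈ V₀, 0 < w X) ∧ IsOpen (ĉ '' V₀) ∧ μ.restrict (ĉ '' V₀) = map ĉ ((λ.restrict V₀).withDensity (ofReal ∘ w))`.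
[cite: Helgason2000, Ch. I §1 Thm. 1.14 (13) p. 96] -/
theorem exists_restrict_image_cayleyChart_eq_map' (μa : Measure (arch F E c N J)) [μa.IsHaarMeasure]
    (lam : Measure (archSkew F E c N J)) [lam.IsAddHaarMeasure] :
    ∃ (V₀ : Set (archSkew F E c N J)) (w : archSkew F E c N J → ℝ),
      IsOpen V₀ ∧ (0 : archSkew F E c N J) ∈ V₀ ∧ ContinuousOn w V₀ ∧ (∀ X ∈ V₀, 0 < w X) ∧ IsOpen (cayleyChart F E c N J '' V₀) ∧
      μa.restrict (cayleyChart F E c N J '' V₀) =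
        Measure.map (cayleyChart F E c N J) ((lam.restrict V₀).withDensity fun X => ENNReal.ofReal (w X)) := by
  obtain ⟨V₀, w, h1, h2, -, h4, h5, h6, h7⟩ := exists_restrict_image_cayleyChart_eq_map J μa lam
  exact ⟨V₀, w, h1, h2, h4, h5, h6, h7⟩

end Haar

end UnitaryGroup

end Literature.NumberTheory.Automorphic
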